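import Summits.ValiantsHypothesis.ValiantsHypothesis.Theorems.TwistedDetRankSliceVBPFermionicTwoCycleTwist
import Summits.ValiantsHypothesis.ValiantsHypothesis.Theorems.TwistedDetRankTdrPerNotQP
import Summits.ValiantsHypothesis.ValiantsHypothesis.Theorems.ProofCarryingSymmetryAssembly

/-!
# Crux `TwistedDetRank.SliceVBPFermionic` (stmt-ValiantsHypothesis-17991, X2b) — twisted-rank
# transfer through the return gadget: non-vanishing doubling sums force exponential tdr

Third file of the return-gadget series (ReturnGadget: `f_{2a}(0 Y; J 0) = c_a(χ)·per_a`;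
TwoCycleTwist: the named falsifier `sgn·μ^{c₂}` has `c_a ≠ 0` eventually, hence is `VNP ⊄ VBP`-hard).
Here the RESTRICTED-MODEL shadow of the same projection (all kernel-checked, no named facts):

* `aeval_retSubstFin_twistedDet` — the gadget maps a twisted determinant `det(X ∘ E)` of size `2a`
  to `ε·det(Z ∘ E₂₁) · det(Y ∘ E₁₂)`, a scalar multiple of ONE twisted determinant of size `a`;
* `perPoly_eq_sum_twistedDet_of_gmf` — hence `tdr(per_a) ≤ tdr(f_{2a})` for every class function
  `χ` on `S_{2a}` with `c_a(χ) ≠ 0` (`a ≥ 1`; scalars absorbed into column `0`);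
* `three_pow_le_of_gmf_repr` — with the landed `tdrPerNotQP_exp_lower_bound`
  (`tdr(per_{3m}) ≥ (3/2)^m`): `3^m ≤ r·2^m` for every `r`-term twisted representation of `f_{6m}`;
* `not_qpTdr_of_doublingSum_ne_zero` — a class-function family whose doubling sums are eventually
  non-zero does NOT have quasi-polynomially bounded twisted rank: the CONCLUSION of X2b fails for
  it, unconditionally.  Together with ReturnGadget §4 this pins X2b down on the "non-degenerate"
  sub-slice `{χ : c_a(χ_{2a}) ≠ 0 eventually}`: there X2b says exactly that such families are not in
  the VBP slice, which follows from (and at `χ ≡ 1` is) `DcPerSuperpolynomial ℂ`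
  (`sliceVBPFermionic_restricted_of_dcPerSuperpolynomial`).  All content of X2b beyond Valiant's
  per/det conjecture lives on the degenerate sub-slice `c_a(χ_{2a}) = 0` infinitely often
  (e.g. `D^even = sgn·[all cycles even]`, `G_n`, the fermionants `Ferm_k`, `k ∈ ℕ`).
* `twoCycleTwist_not_qpTdr` — in particular the named falsifier `sgn·μ^{c₂}` (`μ ≠ 1`) has
  super-quasi-polynomial tdr (`≥ (3/2)^{⌊n/6⌋}`; the item quotes `2^{n/4}` from the block-swap
  flattening), and `sliceVBPFermionic_at_twoCycleTwist` — X2b holds AT this family iff the family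
  is not in the VBP slice, which `DcPerSuperpolynomial ℂ` implies.

HONEST FRAMING.  Census work: X2b itself is ≥ `VNP ⊄ VBP` and is neither proved nor refuted here;
`VP ≠ VNP` is not moved by this item.

References: L. G. Valiant, STOC 1979; P. Bürgisser 2000 §2.5; J. M. Landsberg, *Geometry and
Complexity Theory* (2017) §6 (flattenings); this route's Theorems/TwistedDetRankTdrPerNotQP.lean.
-/

-- single-conjunct layout: Sub = Summit, duplicated namespace component intended
set_option linter.dupNamespace false

noncomputable section

namespace Summit.ValiantsHypothesis.ValiantsHypothesis.Theorems.TwistedDetRankSliceVBPFermionic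

open Equiv MvPolynomial Literature.Computability.AlgebraicComplexity
open Summit.ValiantsHypothesis.ValiantsHypothesis.Theorems.TwistedDetRankFermionicNormalForm
open scoped BigOperators

/-! ## §1 The gadget on twisted determinants; transfer of twisted rank to the permanent -/

section TdrTransfer

variable {a : ℕ}

/-- A twisted determinant `det(X ∘ E)` is the GMF of `σ ↦ sgn σ · Π_i E (σ i) i`. [folklore] -/
theorem twistedDet_eq_gmf {n : ℕ} (E : Matrix (Fin n) (Fin n) ℂ) :
    (Matrix.of fun i j => C (E i j) * (X (i, j) : MvPolynomial (Fin n × Fin n) ℂ)).det =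
      ∑ σ : Perm (Fin n), C (((Perm.sign σ : ℤ) : ℂ) * ∏ i, E (σ i) i) *
        ∏ i, (X (σ i, i) : MvPolynomial (Fin n × Fin n) ℂ) := by
  rw [TwistedDetRankTdrSuperadditive.twistedDet_eq_sum_monomial]
  refine Finset.sum_congr rfl fun σ _ => ?_
  rw [TwistedDetRankTdrSuperadditive.prod_X_eq_monomial, C_mul_monomial, mul_one]

/-- Absorbing a scalar into column `0` of a twist, polynomial form (`a ≥ 1`). [folklore] -/
theorem C_mul_twistedDet (ha : 1 ≤ a) (s : ℂ) (F : Matrix (Fin a) (Fin a) ℂ) :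
    C s * (Matrix.of fun i j => C (F i j) * (X (i, j) : MvPolynomial (Fin a × Fin a) ℂ)).det =
      (Matrix.of fun i j => C ((if j = (⟨0, ha⟩ : Fin a) then s else 1) * F i j) *
        (X (i, j) : MvPolynomial (Fin a × Fin a) ℂ)).det := by
  rw [twistedDet_eq_gmf, twistedDet_eq_gmf, Finset.mul_sum]
  refine Finset.sum_congr rfl fun σ _ => ?_
  rw [← mul_assoc, ← map_mul]
  congr 2
  rw [Finset.prod_mul_distrib, Finset.prod_ite_eq']
  simp only [Finset.mem_univ, if_true]
  ring

/-- **The gadget on a twisted determinant.** Substituting `(0 Y; Z 0)` into `det(X ∘ E)` gives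
the scalar `ε · Σ_p sgn p Π_i Z_{p i,i} E_{inr (p i), inl i}` (`= ε det(Z ∘ E₂₁)`, `ε` the sign of
the block swap) times the twisted determinant `det(Y ∘ E₁₂)` of the `(inl, inr)` block. [folklore] -/
theorem aeval_retSubstFin_twistedDet (Z : Matrix (Fin a) (Fin a) ℂ)
    (E : Matrix (Fin (a + a)) (Fin (a + a)) ℂ) :
    aeval (retSubstFin Z) (Matrix.of fun i j => C (E i j) *
        (X (i, j) : MvPolynomial (Fin (a + a) × Fin (a + a)) ℂ)).det =
      C (((Perm.sign (Equiv.sumComm (Fin a) (Fin a) : Perm (Fin a ⊕ Fin a)) : ℤ) : ℂ) *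
          ∑ p : Perm (Fin a), ((Perm.sign p : ℤ) : ℂ) *
            ∏ i, Z (p i) i * E (finSumFinEquiv (Sum.inr (p i))) (finSumFinEquiv (Sum.inl i))) *
        (Matrix.of fun i j => C (E (finSumFinEquiv (Sum.inl i)) (finSumFinEquiv (Sum.inr j))) *
          (X (i, j) : MvPolynomial (Fin a × Fin a) ℂ)).det := by
  rw [twistedDet_eq_gmf, aeval_retSubstFin_gmf, twistedDet_eq_gmf, Finset.mul_sum]
  refine Finset.sum_congr rfl fun q _ => ?_
  rw [← mul_assoc, ← map_mul]
  congr 2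
  -- the inner sum over `p`, term by term
  have hterm : ∀ p : Perm (Fin a),
      (∏ i, Z (p i) i) * ((fun σ : Perm (Fin (a + a)) => ((Perm.sign σ : ℤ) : ℂ) * ∏ i, E (σ i) i)
          (finSumFinEquiv.permCongr (swapPerm p q))) =
        ((Perm.sign (Equiv.sumComm (Fin a) (Fin a) : Perm (Fin a ⊕ Fin a)) : ℤ) : ℂ) *
          (((Perm.sign p : ℤ) : ℂ) *
            ∏ i, Z (p i) i * E (finSumFinEquiv (Sum.inr (p i))) (finSumFinEquiv (Sum.inl i))) *
          (((Perm.sign q : ℤ) : ℂ) *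
            ∏ i, E (finSumFinEquiv (Sum.inl (q i))) (finSumFinEquiv (Sum.inr i))) := by
    intro p
    have hprod : ∏ i, E ((finSumFinEquiv.permCongr (swapPerm p q)) i) i =
        (∏ i, E (finSumFinEquiv (Sum.inr (p i))) (finSumFinEquiv (Sum.inl i))) *
          ∏ i, E (finSumFinEquiv (Sum.inl (q i))) (finSumFinEquiv (Sum.inr i)) := by
      rw [← Fintype.prod_equiv (finSumFinEquiv : Fin a ⊕ Fin a ≃ Fin (a + a))
        (fun z => E (finSumFinEquiv (swapPerm p q z)) (finSumFinEquiv z))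
        (fun i => E ((finSumFinEquiv.permCongr (swapPerm p q)) i) i)
        (fun z => by simp [Equiv.permCongr_apply])]
      exact prod_swapPerm p q (fun u v => E (finSumFinEquiv u) (finSumFinEquiv v))
    show (∏ i, Z (p i) i) * (((Perm.sign (finSumFinEquiv.permCongr (swapPerm p q)) : ℤ) : ℂ) *
        ∏ i, E ((finSumFinEquiv.permCongr (swapPerm p q)) i) i) = _
    rw [Perm.sign_permCongr, sign_swapPerm, hprod, Finset.prod_mul_distrib, Units.val_mul,
      Units.val_mul, Int.cast_mul, Int.cast_mul]
    ring
  refine (Fintype.sum_congr _ _ hterm).trans ?_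
  rw [← Finset.sum_mul, ← Finset.mul_sum]

/-- **Twisted-rank transfer through the `J`-gadget.** If the GMF of a class function `χ` on
`S_{a+a}` (`a ≥ 1`) is a sum of `r` twisted determinants and `c_a(χ) ≠ 0`, then `per_a` is a
sum of `r` twisted determinants: `tdr(per_a) ≤ tdr(f_{2a})`. [folklore] -/
theorem perPoly_eq_sum_twistedDet_of_gmf (ha : 1 ≤ a) (χ : Perm (Fin (a + a)) → ℂ)
    (hχ : ∀ σ τ : Perm (Fin (a + a)), χ (τ * σ * τ⁻¹) = χ σ) (hd : doublingSum χ ≠ 0) {r : ℕ}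
    (E : Fin r → Matrix (Fin (a + a)) (Fin (a + a)) ℂ)
    (hE : (∑ σ : Perm (Fin (a + a)), C (χ σ) *
        ∏ i, (X (σ i, i) : MvPolynomial (Fin (a + a) × Fin (a + a)) ℂ)) =
      ∑ t, (Matrix.of fun i j => C (E t i j) * MvPolynomial.X (i, j)).det) :
    ∃ E' : Fin r → Matrix (Fin a) (Fin a) ℂ,
      perPoly (Fin a) ℂ = ∑ t, (Matrix.of fun i j => C (E' t i j) * MvPolynomial.X (i, j)).det := by
  have h := congrArg (aeval (retSubstFin (Matrix.of fun _ _ => (1 : ℂ)))) hE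
  rw [aeval_retSubstFin_ones_gmf χ hχ, map_sum] at h
  simp_rw [aeval_retSubstFin_twistedDet] at h
  -- divide by `c_a(χ)` and absorb all scalars into column `0`
  have h2 : perPoly (Fin a) ℂ = C (doublingSum χ)⁻¹ * (C (doublingSum χ) * perPoly (Fin a) ℂ) := by
    rw [← mul_assoc, ← map_mul, inv_mul_cancel₀ hd, map_one, one_mul]
  rw [h, Finset.mul_sum] at h2
  simp_rw [← mul_assoc, ← map_mul, C_mul_twistedDet ha] at h2
  exact ⟨fun t i j => (if j = (⟨0, ha⟩ : Fin a) then
      (doublingSum χ)⁻¹ * (((Perm.sign (Equiv.sumComm (Fin a) (Fin a) : Perm (Fin a ⊕ Fin a)) : ℤ) : ℂ) *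
        ∑ p : Perm (Fin a), ((Perm.sign p : ℤ) : ℂ) *
          ∏ i, (Matrix.of fun _ _ => (1 : ℂ) : Matrix (Fin a) (Fin a) ℂ) (p i) i *
            E t (finSumFinEquiv (Sum.inr (p i))) (finSumFinEquiv (Sum.inl i))) else 1) *
      E t (finSumFinEquiv (Sum.inl i)) (finSumFinEquiv (Sum.inr j)), h2⟩

/-- **Exponential twisted rank for every class function with non-vanishing doubling sum at
`a = 3m`:** `3^m ≤ r · 2^m` for any representation of `f_{6m}` by `r` twisted determinants
(transfer to `per_{3m}`, then the landed `tdrPerNotQP_exp_lower_bound`). [folklore] -/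
theorem three_pow_le_of_gmf_repr (m : ℕ) (hm : 1 ≤ m) (χ : Perm (Fin (m * 3 + m * 3)) → ℂ)
    (hχ : ∀ σ τ : Perm (Fin (m * 3 + m * 3)), χ (τ * σ * τ⁻¹) = χ σ) (hd : doublingSum χ ≠ 0)
    {r : ℕ} (E : Fin r → Matrix (Fin (m * 3 + m * 3)) (Fin (m * 3 + m * 3)) ℂ)
    (hE : (∑ σ : Perm (Fin (m * 3 + m * 3)), C (χ σ) *
        ∏ i, (X (σ i, i) : MvPolynomial (Fin (m * 3 + m * 3) × Fin (m * 3 + m * 3)) ℂ)) =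
      ∑ t, (Matrix.of fun i j => C (E t i j) * MvPolynomial.X (i, j)).det) :
    3 ^ m ≤ r * 2 ^ m := by
  obtain ⟨E', hE'⟩ := perPoly_eq_sum_twistedDet_of_gmf (by omega) χ hχ hd E hE
  exact tdrPerNotQP_exp_lower_bound m r E' hE'

/-- **A class-function family with eventually non-zero doubling sums does NOT have
quasi-polynomially bounded twisted rank** — the conclusion of X2b FAILS for it, unconditionally
(so on this sub-slice X2b is exactly the statement that the family is not in the VBP slice, which
follows from `DcPerSuperpolynomial ℂ` by `not_dcPerSuperpolynomial_of_hasDetRepr_of_doublingSum_ne_zero`).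
[folklore] -/
theorem not_qpTdr_of_doublingSum_ne_zero (χ : (n : ℕ) → Perm (Fin n) → ℂ)
    (hχ : ∀ (n : ℕ) (σ τ : Perm (Fin n)), χ n (τ * σ * τ⁻¹) = χ n σ)
    {a₀ : ℕ} (hd : ∀ a, a₀ ≤ a → doublingSum (χ (a + a)) ≠ 0) :
    ¬ ∃ c : ℕ, ∀ n : ℕ, 1 ≤ n → ∃ r ≤ 2 ^ ((Nat.log 2 n + c) ^ c),
      ∃ E : Fin r → Matrix (Fin n) (Fin n) ℂ,
        (∑ σ : Perm (Fin n), C (χ n σ) *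
            ∏ i, (X (σ i, i) : MvPolynomial (Fin n × Fin n) ℂ)) =
          ∑ t, (Matrix.of fun i j => C (E t i j) * MvPolynomial.X (i, j)).det := by
  rintro ⟨c, hc⟩
  -- `(log₂ n + c)^c < (log₂ 1.5 / 6) · n` eventually
  have hε : (0 : ℝ) < Real.logb 2 (3 / 2) / 6 :=
    div_pos (Real.logb_pos one_lt_two (by norm_num)) (by norm_num)
  obtain ⟨n₀, hn₀⟩ :=
    Summit.ValiantsHypothesis.Theorems.ProofCarryingSymmetry.natLog_add_pow_lt_mul_eventually c hε
  set m : ℕ := max (max a₀ n₀) 1 with hm_def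
  have hm1 : 1 ≤ m := le_max_right _ _
  have hma : a₀ ≤ m * 3 := by
    have : a₀ ≤ m := (le_max_left _ _).trans (le_max_left _ _); omega
  have hmn : n₀ ≤ m * 3 + m * 3 := by
    have : n₀ ≤ m := (le_max_right _ _).trans (le_max_left _ _); omega
  obtain ⟨r, hr, E, hE⟩ := hc (m * 3 + m * 3) (by omega)
  have h3 : 3 ^ m ≤ r * 2 ^ m := three_pow_le_of_gmf_repr m hm1 (χ _) (hχ _) (hd _ hma) E hE
  have hlt := hn₀ (m * 3 + m * 3) hmn
  set k : ℕ := (Nat.log 2 (m * 3 + m * 3) + c) ^ c with hk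
  have hr' : (r : ℝ) ≤ (2 : ℝ) ^ (k : ℝ) := by
    rw [Real.rpow_natCast]; exact_mod_cast hr
  have h7 : Real.logb 2 (3 / 2) / 6 * ((m * 3 + m * 3 : ℕ) : ℝ) = Real.logb 2 (3 / 2) * (m : ℝ) := by
    push_cast; ring
  have hexp : (k : ℝ) < Real.logb 2 (3 / 2) * (m : ℝ) := by
    rw [← h7]; exact_mod_cast hlt
  have h5 : (2 : ℝ) ^ (k : ℝ) < (3 / 2 : ℝ) ^ m :=
    calc (2 : ℝ) ^ (k : ℝ) < (2 : ℝ) ^ (Real.logb 2 (3 / 2) * (m : ℝ)) :=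
          Real.rpow_lt_rpow_of_exponent_lt one_lt_two hexp
      _ = ((2 : ℝ) ^ Real.logb 2 (3 / 2)) ^ (m : ℝ) := Real.rpow_mul (by norm_num) _ _
      _ = (3 / 2 : ℝ) ^ (m : ℝ) := by
          rw [Real.rpow_logb (by norm_num) (by norm_num) (by norm_num)]
      _ = (3 / 2 : ℝ) ^ m := Real.rpow_natCast _ _
  have h6 : (3 / 2 : ℝ) ^ m ≤ r := by
    rw [div_pow, div_le_iff₀ (pow_pos two_pos _)]
    exact_mod_cast h3
  linarith

end TdrTransfer

/-! ## §2 Consequences for X2b on the non-degenerate sub-slice and at the named falsifier -/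

section Consequences

/-- **X2b on the non-degenerate sub-slice follows from Valiant's determinantal hypothesis.**  For
a class-function family whose doubling sums are eventually non-zero, the instance of
`SliceVBPFermionic` holds as soon as `DcPerSuperpolynomial ℂ` does — vacuously: such a family is
then not in the VBP slice (ReturnGadget §4).  (Its conclusion is false by
`not_qpTdr_of_doublingSum_ne_zero`, so on this sub-slice X2b is EXACTLY "not in the VBP slice".)
[folklore] -/
theorem sliceVBPFermionic_restricted_of_dcPerSuperpolynomial (h : DcPerSuperpolynomial ℂ)
    (χ : (n : ℕ) → Perm (Fin n) → ℂ)
    (hχ : ∀ (n : ℕ) (σ τ : Perm (Fin n)), χ n (τ * σ * τ⁻¹) = χ n σ)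
    {a₀ : ℕ} (hd : ∀ a, a₀ ≤ a → doublingSum (χ (a + a)) ≠ 0) :
    (∃ c : ℕ, ∀ n : ℕ, ∃ m ≤ n ^ c + c,
      HasDetRepr (∑ σ : Perm (Fin n), C (χ n σ) *
        ∏ i, (X (σ i, i) : MvPolynomial (Fin n × Fin n) ℂ)) m) →
    ∃ c : ℕ, ∀ n : ℕ, 1 ≤ n → ∃ r ≤ 2 ^ ((Nat.log 2 n + c) ^ c),
      ∃ E : Fin r → Matrix (Fin n) (Fin n) ℂ,
        (∑ σ : Perm (Fin n), C (χ n σ) *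
            ∏ i, (X (σ i, i) : MvPolynomial (Fin n × Fin n) ℂ)) =
          ∑ t, (Matrix.of fun i j => C (E t i j) * MvPolynomial.X (i, j)).det :=
  fun hdc => absurd h (not_dcPerSuperpolynomial_of_hasDetRepr_of_doublingSum_ne_zero χ hχ hd hdc)

/-- **The named falsifier has super-quasi-polynomial twisted rank** (unconditionally): for
`μ ≠ 1` the GMF family of `sgn · μ^{c₂}` is not a quasi-polynomial sum of twisted determinants
(`tdr ≥ (3/2)^{⌊n/6⌋}` along `n = 6m`, by transfer to `per_{3m}`). [folklore] -/
theorem twoCycleTwist_not_qpTdr {μ : ℂ} (hμ : μ ≠ 1) :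
    ¬ ∃ c : ℕ, ∀ n : ℕ, 1 ≤ n → ∃ r ≤ 2 ^ ((Nat.log 2 n + c) ^ c),
      ∃ E : Fin r → Matrix (Fin n) (Fin n) ℂ,
        (∑ σ : Perm (Fin n), C (twoCycleTwist μ n σ) *
            ∏ i, (X (σ i, i) : MvPolynomial (Fin n × Fin n) ℂ)) =
          ∑ t, (Matrix.of fun i j => C (E t i j) * MvPolynomial.X (i, j)).det := by
  obtain ⟨a₀, ha₀⟩ := doublingSum_twoCycleTwist_ne_zero hμ
  exact not_qpTdr_of_doublingSum_ne_zero (twoCycleTwist μ) (twoCycleTwist_conj μ) ha₀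

/-- **X2b AT the named falsifier** is equivalent to "the `2`-cycle twist family is not in the VBP
slice" (its conclusion being false), and therefore follows from `DcPerSuperpolynomial ℂ`
(`twoCycleTwist_not_hasDetRepr_of_dcPerSuperpolynomial`): the instance carries no content beyond
Valiant's per/det conjecture. [folklore] -/
theorem sliceVBPFermionic_at_twoCycleTwist {μ : ℂ} (hμ : μ ≠ 1) (h : DcPerSuperpolynomial ℂ) :
    (∃ c : ℕ, ∀ n : ℕ, ∃ m ≤ n ^ c + c,
      HasDetRepr (∑ σ : Perm (Fin n), C (twoCycleTwist μ n σ) *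
        ∏ i, (X (σ i, i) : MvPolynomial (Fin n × Fin n) ℂ)) m) →
    ∃ c : ℕ, ∀ n : ℕ, 1 ≤ n → ∃ r ≤ 2 ^ ((Nat.log 2 n + c) ^ c),
      ∃ E : Fin r → Matrix (Fin n) (Fin n) ℂ,
        (∑ σ : Perm (Fin n), C (twoCycleTwist μ n σ) *
            ∏ i, (X (σ i, i) : MvPolynomial (Fin n × Fin n) ℂ)) =
          ∑ t, (Matrix.of fun i j => C (E t i j) * MvPolynomial.X (i, j)).det :=
  fun hdc => absurd hdc (twoCycleTwist_not_hasDetRepr_of_dcPerSuperpolynomial h hμ)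

end Consequences

end Summit.ValiantsHypothesis.ValiantsHypothesis.Theorems.TwistedDetRankSliceVBPFermionic

end
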